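import Literature.Combinatorics.StablePolynomials.MultiAffinePart
import HarnessLib

/-!
# The Heilmann–Lieb theorem via the multi-affine part operator (Borcea–Brändén II, Theorem 8.9, §8.4)

J. Borcea, P. Brändén, *The Lee–Yang and Pólya–Schur programs. II.*, Comm. Pure Appl. Math. 62 (2009)
1595–1631 (arXiv:0809.3087), §8.4:

> Recall that a matching in a graph `G = (V,E)` is a subset `M` of `E` such that no vertex of the graph `(V,M)` has
> degree exceeding one. …
>
> **Theorem 8.9** (Heilmann–Lieb [HL]). Let `G = (V,E)` be a loopless graph and define its matching polynomial with
> edge weights `{λ_e}_{e∈E}` and vertex weights `{z_i}_{i∈V}` as `M_G(z,λ) = Σ_{matchings M} Π_{e=ij∈M} λ_e z_i z_j`.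
> If `λ_e ≥ 0`, `e ∈ E`, then `M_G(z,λ)` is a weakly Hurwitz stable polynomial (in `z`).
>
> … form the "test" polynomial `F_G(z,λ) = Π_{e={i,j}∈E} (1 + λ_e z_i z_j)` … This polynomial is weakly Hurwitz
> stable in the `z_i`'s … It is easy to see that `M_G(z,λ) = MAP[F_G(z,λ)]`, which yields the Heilmann–Lieb theorem.

A (simple, loopless) graph on the finite vertex type `σ` is given by its edge set `E : Finset (Finset σ)` of
two-element vertex sets (parallel edges of a multigraph are absorbed into the weights for `M_G`); a matching is
an edge subset in which every vertex has degree `≤ 1` (`IsMatching`, the printed definition).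

## Contents

* `edgeDegVec` (the degree vector `deg(V,H)` as an exponent vector), `edgeDegVec_apply`, `IsMatching`,
  `testPolynomial` (`F_G`), `matchingPolynomial` (`M_G`).
* `prod_prod_X_eq_monomial_edgeDegVec`, `testPolynomial_eq_sum`, **`multiAffinePart_testPolynomial`**
  (`M_G = MAP[F_G]`), `testPolynomial_weaklyHurwitzStable`, `constantCoeff_testPolynomial`,
  **`heilmannLieb_matchingPolynomial_weaklyHurwitzStable`** (Theorem 8.9).

## References

* [BorceaBranden2009II] J. Borcea, P. Brändén, Comm. Pure Appl. Math. 62 (2009) 1595–1631, §8.4 Thm 8.9.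
* O. J. Heilmann, E. H. Lieb, *Theory of monomer-dimer systems*, Comm. Math. Phys. 25 (1972) 190–232 (the
  reference [HL] of [BorceaBranden2009II]).
-/

noncomputable section

open MvPolynomial Finset

namespace Literature.Combinatorics.StablePolynomials

variable {σ : Type*} [Fintype σ] [DecidableEq σ]

/-! ## §1 Graphs as edge sets, matchings, `F_G` and `M_G` -/

section Defs

omit [Fintype σ] in
/-- **The degree vector `deg(V,H)`** of an edge set `H` as an exponent vector: `Σ_{e∈H} 𝟙_e`.
[cite: BorceaBranden2009II, §8.4–8.5 (`deg(V,H)`, `z^{deg(V,H)}`)] -/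
def edgeDegVec (H : Finset (Finset σ)) : σ →₀ ℕ :=
  ∑ e ∈ H, ∑ v ∈ e, Finsupp.single v 1

omit [Fintype σ] in
/-- `deg(V,H)_v` is the number of edges of `H` containing `v`. [cite: BorceaBranden2009II, §8.4 (degree in `(V,M)`)] -/
theorem edgeDegVec_apply (H : Finset (Finset σ)) (v : σ) : edgeDegVec H v = (H.filter fun e => v ∈ e).card := by
  rw [edgeDegVec, Finsupp.finsetSum_apply, card_filter]
  exact sum_congr rfl fun e _ => by rw [sum_single_one_apply]

omit [Fintype σ] in
/-- **Matching**: an edge subset in which no vertex has degree exceeding one.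
[cite: BorceaBranden2009II, §8.4 (definition of a matching)] -/
abbrev IsMatching (M : Finset (Finset σ)) : Prop :=
  ∀ v, (M.filter fun e => v ∈ e).card ≤ 1

omit [Fintype σ] [DecidableEq σ] in
/-- **The test polynomial `F_G(z,λ) = Π_{e={i,j}∈E} (1 + λ_e z_i z_j)`.**
[cite: BorceaBranden2009II, §8.4 (definition of `F_G`)] -/
def testPolynomial (E : Finset (Finset σ)) (wt : Finset σ → ℝ) : MvPolynomial σ ℂ :=
  ∏ e ∈ E, (1 + C ((wt e : ℝ) : ℂ) * ∏ v ∈ e, X v)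

/-- **The matching polynomial `M_G(z,λ) = Σ_{matchings M} Π_{e=ij∈M} λ_e z_i z_j`.**
[cite: BorceaBranden2009II, §8.4 Thm. 8.9 (definition of `M_G`)] -/
def matchingPolynomial (E : Finset (Finset σ)) (wt : Finset σ → ℝ) : MvPolynomial σ ℂ :=
  ∑ M ∈ E.powerset, if IsMatching M then C (∏ e ∈ M, ((wt e : ℝ) : ℂ)) * ∏ e ∈ M, ∏ v ∈ e, X v else 0

end Defs

/-! ## §2 `M_G = MAP[F_G]` -/

section Identity

omit [Fintype σ] in
/-- `Π_{e∈H} z^e = z^{deg(V,H)}`. [cite: BorceaBranden2009II, §8.5 (`z^{deg(V,H)}`)] -/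
theorem prod_prod_X_eq_monomial_edgeDegVec (H : Finset (Finset σ)) :
    (∏ e ∈ H, ∏ v ∈ e, X v : MvPolynomial σ ℂ) = monomial (edgeDegVec H) 1 := by
  induction H using Finset.induction_on with
  | empty => rw [prod_empty, edgeDegVec, sum_empty]; rfl
  | insert e H he ih =>
    rw [prod_insert he, ih]
    unfold edgeDegVec
    rw [sum_insert he, prod_X_eq_monomial, monomial_mul, mul_one]

omit [Fintype σ] in
/-- **`F_G = Σ_{H ⊆ E} λ^H z^{deg(V,H)}`.** [cite: BorceaBranden2009II, §8.4–8.5 (expansion of `F_G`)] -/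
theorem testPolynomial_eq_sum (E : Finset (Finset σ)) (wt : Finset σ → ℝ) :
    testPolynomial E wt = ∑ H ∈ E.powerset, monomial (edgeDegVec H) (∏ e ∈ H, ((wt e : ℝ) : ℂ)) := by
  rw [testPolynomial, prod_one_add]
  refine sum_congr rfl fun H _ => ?_
  rw [prod_mul_distrib, ← map_prod, prod_prod_X_eq_monomial_edgeDegVec, C_mul_monomial, mul_one]

/-- **`M_G(z,λ) = MAP[F_G(z,λ)]`.** [cite: BorceaBranden2009II, §8.4 ("`M_G(z,λ) = MAP[F_G(z,λ)]`")] -/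
theorem multiAffinePart_testPolynomial (E : Finset (Finset σ)) (wt : Finset σ → ℝ) :
    multiAffinePart (testPolynomial E wt) = matchingPolynomial E wt := by
  rw [testPolynomial_eq_sum, map_sum, matchingPolynomial]
  refine sum_congr rfl fun H _ => ?_
  rw [multiAffinePart_monomial, prod_prod_X_eq_monomial_edgeDegVec, C_mul_monomial, mul_one]
  have hiff : (∀ v, edgeDegVec H v ≤ 1) ↔ IsMatching H := by
    simp only [edgeDegVec_apply, IsMatching]
  by_cases hM : IsMatching H
  · rw [if_pos (hiff.2 hM), if_pos hM]
  · rw [if_neg (fun h => hM (hiff.1 h)), if_neg hM]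

end Identity

/-! ## §3 Theorem 8.9 -/

section HeilmannLieb

omit [Fintype σ] in
/-- **`F_G` is weakly Hurwitz stable** (`1 + λ z_i z_j ≠ 0` for `Re z_i, Re z_j > 0`, `λ ≥ 0`).
[cite: BorceaBranden2009II, §8.4 ("This polynomial is weakly Hurwitz stable in the `z_i`'s")] -/
theorem testPolynomial_weaklyHurwitzStable {E : Finset (Finset σ)} (hE : ∀ e ∈ E, e.card = 2)
    {wt : Finset σ → ℝ} (hwt : ∀ e ∈ E, 0 ≤ wt e) : IsHThetaStable (Real.pi / 2) (testPolynomial E wt) := by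
  rw [isHThetaStable_pi_div_two_iff]
  intro z hz
  rw [testPolynomial, _root_.map_prod]
  refine prod_ne_zero_iff.2 fun e he => ?_
  obtain ⟨i, j, hij, rfl⟩ := card_eq_two.1 (hE e he)
  rw [_root_.map_add, _root_.map_one, _root_.map_mul, eval_C, _root_.map_prod, prod_pair hij, eval_X, eval_X]
  rcases (hwt _ he).eq_or_lt with h0 | hpos
  · rw [← h0]
    simp
  · have hre : 0 < (((wt {i, j} : ℝ) : ℂ) * z i).re := by
      rw [Complex.re_ofReal_mul]
      exact mul_pos hpos (hz i)
    have h := one_add_mul_ne_zero_of_re_pos hre (hz j)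
    rwa [mul_assoc] at h

omit [Fintype σ] in
/-- The constant term of `F_G` is `1` (edges are non-empty). [cite: BorceaBranden2009II, §8.4 (`F_G`)] -/
theorem constantCoeff_testPolynomial {E : Finset (Finset σ)} (hE : ∀ e ∈ E, e.card = 2)
    (wt : Finset σ → ℝ) : constantCoeff (testPolynomial E wt) = 1 := by
  rw [testPolynomial, map_prod]
  refine prod_eq_one fun e he => ?_
  obtain ⟨i, j, hij, rfl⟩ := card_eq_two.1 (hE e he)
  rw [map_add, map_one, map_mul, map_prod, prod_pair hij, constantCoeff_X, zero_mul, mul_zero, add_zero]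

/-- **Borcea–Brändén II, Theorem 8.9 (Heilmann–Lieb).** For a loopless graph with non-negative edge weights the
matching polynomial `M_G(z,λ) = Σ_{matchings M} Π_{e=ij∈M} λ_e z_i z_j` is weakly Hurwitz stable. Proof as printed
(§8.4): `M_G = MAP[F_G]`, `F_G` is weakly Hurwitz stable and `MAP` preserves weak Hurwitz stability
(`multiAffinePart_weaklyHurwitzStable`); `M_G ≢ 0` since its constant term is `1`.
[cite: BorceaBranden2009II, §8.4 Thm. 8.9] -/
theorem heilmannLieb_matchingPolynomial_weaklyHurwitzStable {E : Finset (Finset σ)} (hE : ∀ e ∈ E, e.card = 2)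
    {wt : Finset σ → ℝ} (hwt : ∀ e ∈ E, 0 ≤ wt e) :
    IsHThetaStable (Real.pi / 2) (matchingPolynomial E wt) := by
  rw [← multiAffinePart_testPolynomial]
  rcases multiAffinePart_weaklyHurwitzStable (testPolynomial_weaklyHurwitzStable hE hwt) with h | h
  · exact h
  · exfalso
    have h0 := congrArg (coeff 0) h
    rw [coeff_multiAffinePart, if_pos (fun i => by simp), coeff_zero, ← constantCoeff_eq,
      constantCoeff_testPolynomial hE] at h0
    exact one_ne_zero h0

end HeilmannLieb

end Literature.Combinatorics.StablePolynomials

end
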